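import Literature.AlgebraicGeometry.HodgeTheory.UnitaryHodgeGroupSlotsHodgeClasses
import Literature.AlgebraicGeometry.HodgeTheory.RibetTypeOnePowersHodgeClasses
import HarnessLib

/-!
# `Hg = U_K` ⟹ the Hodge classes on all powers are generated by divisor classes, II: the FFT assembly and the geometric theorem (Moonen–Zarhin 1999 (1.8), Hazama / Murty, for `D = K` imaginary quadratic; Ribet 1983 Thm. 0 and Thm. 3 with the Lie step as a hypothesis)

Family `hodge`, layer `Literature/AlgebraicGeometry/HodgeTheory`. Research context: cell `pub-hodgeav-hg6` (LADDER-HodgeAV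
PERC-SHAPE row 2, «base of HC ladder», req-37 Q2b TABLE X; HONEST FRAMING: nothing here proves HC, HC_AV or HC_CM;
research route conditional on HC_CM where HC_CM appears — it does not appear here; not a corollary). UNCONDITIONAL for
the class of abelian varieties it names; theorems only, no definition, no named fact (D-0026), no `sorry`. Part II of two
(part I: `UnitaryHodgeGroupSlotsHodgeClasses` — Theorem L′ under `hU` and the invariance theorem).

This file is the UNITARY twin of the tree's `SymplecticHodgeGroupPowersHodgeClasses` §3 («`Hg = Sp` ⟹ `B = D` on all
powers») and the MULTIPLICITY-FREE form of `UnitaryTypeSlotsHodgeClasses` §4 / `RibetTypeOnePowersHodgeClasses` §3 (Ribet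
type `(m,1)`) and `RibetTypeTwoThreePowersHodgeClasses` §§3–5 (type `(2,3)`): the Lie step «`Lie Hg(H¹(A)) ⊗ ℂ ⊇
𝔲_K(V,ψ) ⊗ ℂ ≅ 𝔤𝔩(W)`» is the HYPOTHESIS `hU` («every `(φ^*)_ℂ`-commuting `ψ_ℂ`-skew operator of `H¹(A; ℂ)` lies in
`Lie Hg ⊗ ℂ`», i.e. `Hg(A) = U_K(V, ψ)`), and the unipotent bridge, the tensor FFT for `GL(W)` and the crossed classes are the
SAME text for every pair of multiplicities `(n′, n″)`; everything is derived by name from the tree (the 40-line FFT body of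
`AVSlots.unitaryHodgeClasses_divisorial` is restated ONCE as the reusable §3 lemma for arbitrary letter families, credited).

THE PRINT. Moonen–Zarhin 1999 (1.8) [corpus: paper:arxiv-math_9901113 p0004 L72–88]: «It was shown by Hazama and Murty
(independently) that `Hg(X) = Sp_D(V,φ)` ⟺ (`X` has no factors of type III and `D(Xⁿ) = B(Xⁿ)` for all `n`)», `Sp_D(V,φ)`
the centralizer of `D = End⁰(X)` in `Sp(V,φ)` (p0001 L99); for `D = K` imaginary quadratic `Sp_K(V,φ) = U_K(V,ψ)` (ibid.
(2.3): «`Hg(X) = U_F(V,ψ)`»). Ribet 1983 Thm. 0 (Gordon 6.3.3: «then `Hg(A) = Lf(A)` and thus `Hdg(Aⁿ) = Div(Aⁿ)` for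
`n ≥ 1`»; p. 19: «extend scalars to `ℂ`, so that the unitary group … becomes a general linear group; we omit the invariant
theory arguments»). This file is the direction ⟹ of (1.8) for `D = K`, for every abelian variety with slots over `A`.

MAIN RESULTS.
* §3 `AVSlots.mem_divisorClassesSpan_of_unitaryCoeff` (from ANY killed coefficient function on ANY vector/covector letter
  family with divisorial crossed classes to `Dᵖ(B) ⊗ ℂ`: unipotent bridge + tensor FFT for `GL` + Milne's product
  formula), `AVSlots.unitaryHodgeClasses_divisorial_of_hodgeLieC`, `AVSlots.isDivisorGenerated_of_unitaryData_of_hodgeLieC`.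
* §4 THE GEOMETRIC THEOREM **`AVSlots.isDivisorGenerated_of_hodgeLieC_unitary`**: `φ ≫ φ = −d` (`d > 0`),
  `finrank_ℚ End⁰(A) = 2`, `0 < dim A`, a polarization `ψ` of `H¹(A(ℂ); ℚ)` (Betti universe) with `hU` ⟹ `B•(B) = D•(B) ⊗ ℂ`
  for every `B` with slots over `A`; `AbelianVariety.isDivisorGenerated_powSucc_of_hodgeLieC_unitary` (all powers),
  `AbelianVariety.isDivisorGenerated_of_hodgeLieC_unitary`, `hodgeConjectureFor_powSucc_of_hodgeLieC_unitary`,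
  `hodgeConjectureFor_of_isIsogenous_powSucc_of_hodgeLieC_unitary`.

USE (cell pub-hodgeav-hg6, TABLE X dimension 6): the «`Hg = U_K` hypothesis carrier» for the GENERAL MEMBER of row
8-(4,2) (type IV(1,1), multiplicities `(4,2)`; MZ99 Table 1 ‘general’), and the socket into which an all-member Lie
theorem for `(4,2)` plugs to give `B = D` on all powers with no further port. The special members (`Hg ⊊ U_K`) are not
addressed by anything in this file.

## References

* [MoonenZarhin1999LowDim] B. Moonen, Yu. Zarhin, *Hodge classes on abelian varieties of low dimension*, Math. Ann.
  315 (1999) = arXiv:math/9901113 (held `paper:arxiv-math_9901113`), §1 (1.7)–(1.8), §2 (2.3), §3 (3.1).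
* [Hazama1983] F. Hazama, Tôhoku Math. J. 35 (1983), Thm. (1.1), §3 pp. 305–306.
* [Murty1984] V. K. Murty, *Exceptional Hodge classes on certain abelian varieties*, Math. Ann. 268 (1984), Thm. 3.1, §3.
* [Ribet1983] K. A. Ribet, *Hodge classes on certain types of abelian varieties*, Amer. J. Math. 105 (1983), Thm. 0 and Thm. 3.
* [Gordon1997] B. B. Gordon, *A survey of the Hodge conjecture for abelian varieties*, arXiv:alg-geom/9709030, Thm. 6.3 (3), §6 pp. 18–19.
* [Milne1999LefschetzClasses] J. S. Milne, *Lefschetz classes on abelian varieties*, Duke Math. J. 96 (1999), Prop. 3.3, Prop. 3.6 (c), Remark 3.7.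
* [GoodmanWallachGTM255] R. Goodman, N. R. Wallach, GTM 255 (2009), Thm. 2.2.2, Thm. 5.3.1.
* [vanGeemen1994HodgeAV] B. van Geemen, LNM 1594 (1994), §2.4, Lemma 3.7, Lemma 5.2.
* [Deligne2000] P. Deligne, *The Hodge conjecture* (Clay, 2000), §1.
-/

noncomputable section

open scoped TensorProduct
open scoped Matrix
open CategoryTheory Module

namespace Literature.AlgebraicGeometry.HodgeTheory

open Literature.AlgebraicTopology.SingularHomology
open Literature.AlgebraicGeometry.Motives (IsSmoothProjective AbelianVariety bettiCohomology
  ofRatClassBaseChange ofRatClassBaseChange_tmul HodgeTensorFacts hodgeTensorFacts_holds)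
open Literature.Barriers.HodgeConjecture
open Literature.AlgebraicGeometry.Motives.HodgeStructure
open Literature.RepresentationTheory.GeneralLinear
open Literature.RepresentationTheory.ClassicalInvariants
open Literature.NumberTheory.DiophantineGeometry
open Literature.AlgebraicGeometry.ComplexMultiplication (bettiRep_of)


/-! ### §3 The assembly from a killed coefficient function: unipotent bridge, tensor FFT for `GL(W)`, crossed classes -/

section Assembly

variable {A B : AbelianVariety ℂ} {n : ℕ} {g : Fin n → (B ⟶ A)}

open scoped Classical in
/-- **From a killed coefficient function to `Dᵖ(B) ⊗ ℂ`** (the FFT half of the assembly, for ANY letter family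
`y₀ : Fin 2 × Fin n₀ → H¹(A(ℂ); ℂ)` of vectors `y₀(0,ℓ)` and covectors `y₀(1,ℓ)`): if `c = ∑_w a(w)·(g y₀)_w` with every
slice of `a` killed by the typed differential of every `X ∈ 𝔤𝔩_{n₀}(ℂ)`, and the CROSSED CLASSES
`∑_ℓ g_j^* y₀(0,ℓ) ⌣ g_{j'}^* y₀(1,ℓ)` lie in `B¹(B) ⊗ ℂ` (`hcross`), then `c ∈ Dᵖ(B) ⊗ ℂ`: Lie invariance ⟹ `GL(W)`-invariance
(Goodman–Wallach Thm. 2.2.2) ⟹ each slice is a combination of complete contractions (tensor FFT for `GL`,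
`mem_span_contractionTensor_of_forall_wordDerAt_mixedLieFamily_eq_zero`, Goodman–Wallach Thm. 5.3.1) ⟹ `±` products of
crossed classes (`Milne1999.sum_contractionTensor_smul_eq`, `sum_cupPowOne_glPairWord_mem`: Milne Prop. 3.6 (c) «each of
which is visibly a product of 2-forms»). This is the body of the tree's `AVSlots.unitaryHodgeClasses_divisorial` after its
first line, stated once for every producer of killed coefficient functions. [cite: Milne1999LefschetzClasses, Prop. 3.6 (c) and Remark 3.7 (pp. 655–656)]
[cite: GoodmanWallachGTM255, Thm. 2.2.2 and Thm. 5.3.1] [cite: Ribet1983, Thm. 0] -/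
theorem AVSlots.mem_divisorClassesSpan_of_unitaryCoeff (hg : AVSlots A B g) {n₀ : ℕ}
    (y₀ : Fin 2 × Fin n₀ → complexBetti A.X 1)
    (hcross : ∀ j j' : Fin n, (∑ ℓ : Fin n₀, cupProduct (rfl : 1 + 1 = 2)
        (avLetters g y₀ (j, ((0 : Fin 2), ℓ))) (avLetters g y₀ (j', ((1 : Fin 2), ℓ)))) ∈
      Submodule.span ℂ {c : complexBetti B.X 2 | IsRationalClass c ∧ IsOfHodgeType B.dim B.X 2 1 1 c})
    {p : ℕ} {c : complexBetti B.X (2 * p)} (a : (Fin (2 * p) → (Fin n × Fin 2) × Fin n₀) → ℂ)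
    (hca : wordEval (cupPowOneAlt ℂ (Motives.ComplexPoints B.X) (2 * p))
        (fun x : (Fin n × Fin 2) × Fin n₀ => avLetters g y₀ (x.1.1, (x.1.2, x.2))) a = c)
    (hkill : ∀ (U : Fin (2 * p) → Fin n × Fin 2) (X : Matrix (Fin n₀) (Fin n₀) ℂ),
        wordDerAt ℂ (fun t => if (U t).2 = 0 then X else -Xᵀ) (wordSlice a U) = 0) :
    c ∈ divisorClassesSpan B.X B.dim p := by
  classical
  have _ := hg
  set y : (Fin n × Fin 2) × Fin n₀ → complexBetti B.X 1 := fun x => avLetters g y₀ (x.1.1, (x.1.2, x.2)) with hy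
  set F := cupPowOneAlt ℂ (Motives.ComplexPoints B.X) (2 * p) with hF
  rw [← hca, wordEval_eq_sum_wordSlice]
  refine Submodule.sum_mem _ fun U _ => ?_
  -- Lie invariance ⟹ `GL(W)`-invariance ⟹ a combination of complete contractions (tensor FFT for `GL`)
  set ty : Fin (2 * p) → Bool := fun t => decide ((U t).2 = 0) with hty
  have hLie : ∀ X : Matrix (Fin n₀) (Fin n₀) ℂ, wordDerAt ℂ (mixedLieFamily ty X) (wordSlice a U) = 0 := by
    intro X
    have hfam : mixedLieFamily ty X = fun t => if (U t).2 = 0 then X else -Xᵀ := by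
      funext t
      simp only [mixedLieFamily, hty, decide_eq_true_eq]
    rw [hfam]
    exact hkill U X
  have hmem := mem_span_contractionTensor_of_forall_wordDerAt_mixedLieFamily_eq_zero ty hLie
  set Λ := Fintype.linearCombination ℂ (fun ε : Word n₀ (2 * p) => F (fun q => y (U q, ε q))) with hΛ
  have hΛapply : ∀ cf : Word n₀ (2 * p) → ℂ, Λ cf = ∑ ε, cf ε • F (fun q => y (U q, ε q)) :=
    fun cf => Fintype.linearCombination_apply ℂ _ cf
  rw [← hΛapply]
  refine (Submodule.span_le (p := (divisorClassesSpan B.X B.dim p).comap Λ)).2 ?_ hmem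
  rintro _ ⟨β, -, rfl⟩
  rw [SetLike.mem_coe, Submodule.mem_comap, hΛapply]
  -- evaluation of a complete contraction: `±` a product of crossed classes
  obtain ⟨π, eP, hsum⟩ := Milne1999.sum_contractionTensor_smul_eq F ty β y U
  rw [hsum]
  refine Submodule.smul_mem _ _ ?_
  simp_rw [hF, cupPowOneAlt_apply]
  refine Milne1999.sum_cupPowOne_glPairWord_mem y p _ _ fun i => ?_
  have h0 : (U (eP.symm i : Fin (2 * p))).2 = 0 := by
    have h := (eP.symm i).2
    simpa [hty] using h
  have h1' : (U (β (eP.symm i) : Fin (2 * p))).2 = 1 := by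
    have h := (β (eP.symm i)).2
    simp only [hty, decide_eq_false_iff_not] at h
    rcases Fin.eq_zero_or_eq_succ (U (β (eP.symm i) : Fin (2 * p))).2 with h' | ⟨j, hj⟩
    · exact absurd h' h
    · rw [hj, Fin.eq_zero j]; rfl
  have hyU : ∀ (q : Fin (2 * p)) (ℓ : Fin n₀), y (U q, ℓ) = avLetters g y₀ ((U q).1, ((U q).2, ℓ)) := fun q ℓ => rfl
  simp only [hyU, h0, h1']
  exact hcross _ _

open scoped Classical in
/-- **`Bᵖ(B) ⊆ Dᵖ(B) ⊗ ℂ` for an abelian variety `B` with slots over `A` of unitary type with `Hg = U_K`** (data as in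
`exists_unitaryInvariant_coeff_of_hodgeLieC`), granted that the crossed classes `∑_ℓ g_j^* e_ℓ ⌣ g_{j'}^* f_ℓ` of two slots lie
in `B¹(B) ⊗ ℂ` (`hcross`; Milne Prop. 3.3). MZ99 (1.8) ⟹: «`Hg(X) = Sp_D(V,φ)` … `D(Xⁿ) = B(Xⁿ)` for all `n`»; Gordon 6.3.3:
«then `Hg(A) = Lf(A)` and thus `Hdg(Aⁿ) = Div(Aⁿ)`». [cite: MoonenZarhin1999LowDim, §1 (1.8)] [cite: Ribet1983, Thm. 0 and Thm. 3]
[cite: Gordon1997, Thm. 6.3 (3) and §6 (pp. 18–19)] [cite: Milne1999LefschetzClasses, Prop. 3.6 (c) and Remark 3.7] -/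
theorem AVSlots.unitaryHodgeClasses_divisorial_of_hodgeLieC [HodgeTensorFacts.{0, 0}] (hg : AVSlots A B g)
    (hHD : exists_isReal_hodgeModel) (hI : hodgePQ_independent_of_hodgeModel)
    (ψ : (BettiUniverse.hodge hHD (AbelianVariety.isSmoothProjective_holds (A := A)) 1).Polarization)
    {φ : Module.End ℚ (bettiCohomology A.X 1)}
    (hφE : φ ∈ (BettiUniverse.hodge hHD (AbelianVariety.isSmoothProjective_holds (A := A)) 1).endAlg)
    {d : ℚ} (hd : 0 < d) (hφ2 : φ * φ = -(d • 1))
    (hE : ∀ a ∈ (BettiUniverse.hodge hHD (AbelianVariety.isSmoothProjective_holds (A := A)) 1).endAlg,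
      ∃ x y : ℚ, a = x • 1 + y • φ)
    (hU : ∀ Y : Module.End ℂ (ℂ ⊗[ℚ] bettiCohomology A.X 1), Y * φ.baseChange ℂ = φ.baseChange ℂ * Y →
      (∀ x y, ψ.form.baseChange ℂ (Y x) y + ψ.form.baseChange ℂ x (Y y) = 0) →
        Y ∈ (BettiUniverse.hodge hHD (AbelianVariety.isSmoothProjective_holds (A := A)) 1).hodgeLieC)
    {μ : ℂ} (hμ : μ ^ 2 = -(d : ℂ))
    {n₀ : ℕ} (cb : Module.Basis (Fin 2 × Fin n₀) ℂ (ℂ ⊗[ℚ] bettiCohomology A.X 1)) (κ : Fin n₀ → Fin 2)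
    (hcbW : ∀ ℓ, cb (0, ℓ) ∈ Module.End.eigenspace (φ.baseChange ℂ) μ)
    (hcbW' : ∀ ℓ, cb (1, ℓ) ∈ Module.End.eigenspace (φ.baseChange ℂ) (-μ))
    (hcb0 : ∀ ℓ, κ ℓ = 0 →
      cb (0, ℓ) ∈ (BettiUniverse.hodge hHD (AbelianVariety.isSmoothProjective_holds (A := A)) 1).piece 1 0 ∧
      cb (1, ℓ) ∈ (BettiUniverse.hodge hHD (AbelianVariety.isSmoothProjective_holds (A := A)) 1).piece 0 1)
    (hcb1 : ∀ ℓ, κ ℓ = 1 →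
      cb (0, ℓ) ∈ (BettiUniverse.hodge hHD (AbelianVariety.isSmoothProjective_holds (A := A)) 1).piece 0 1 ∧
      cb (1, ℓ) ∈ (BettiUniverse.hodge hHD (AbelianVariety.isSmoothProjective_holds (A := A)) 1).piece 1 0)
    (hdual : ∀ i j, ψ.form.baseChange ℂ (cb (0, i)) (cb (1, j)) = if i = j then 1 else 0)
    (hcross : ∀ j j' : Fin n, (∑ ℓ : Fin n₀, cupProduct (rfl : 1 + 1 = 2)
        (avLetters g (fun tl : Fin 2 × Fin n₀ =>
          ofRatClassBaseChange (Motives.ComplexPoints A.X) 1 (cb tl)) (j, ((0 : Fin 2), ℓ)))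
        (avLetters g (fun tl : Fin 2 × Fin n₀ =>
          ofRatClassBaseChange (Motives.ComplexPoints A.X) 1 (cb tl)) (j', ((1 : Fin 2), ℓ)))) ∈
      Submodule.span ℂ {c : complexBetti B.X 2 | IsRationalClass c ∧ IsOfHodgeType B.dim B.X 2 1 1 c})
    (p : ℕ) (c : complexBetti B.X (2 * p)) (hcQ : IsRationalClass c)
    (hc : IsOfHodgeType B.dim B.X (2 * p) p p c) :
    c ∈ divisorClassesSpan B.X B.dim p := by
  classical
  rcases Nat.eq_zero_or_pos p with rfl | hp
  · exact AbelianVariety.mem_divisorClassesSpan_zero B c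
  obtain ⟨a, hca, hkill⟩ := hg.exists_unitaryInvariant_coeff_of_hodgeLieC hHD hI ψ hφE hd hφ2 hE hU hμ cb κ
    hcbW hcbW' hcb0 hcb1 hdual hp hcQ hc
  exact hg.mem_divisorClassesSpan_of_unitaryCoeff
    (fun tl : Fin 2 × Fin n₀ => ofRatClassBaseChange (Motives.ComplexPoints A.X) 1 (cb tl)) hcross a hca hkill

/-- **`IsDivisorGenerated B`** (`B•(B) = D•(B) ⊗ ℂ`) for every abelian variety `B` with slots over an abelian variety `A`
carrying unitary data with `Hg = U_K` (`hU`) and crossed classes in `B¹ ⊗ ℂ` — any multiplicities `(n′, n″)`.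
[cite: MoonenZarhin1999LowDim, §1 (1.8)] [cite: Ribet1983, Thm. 0 and Thm. 3] [cite: Gordon1997, Thm. 6.3 (3)] -/
theorem AVSlots.isDivisorGenerated_of_unitaryData_of_hodgeLieC [HodgeTensorFacts.{0, 0}] (hg : AVSlots A B g)
    (hHD : exists_isReal_hodgeModel) (hI : hodgePQ_independent_of_hodgeModel)
    (ψ : (BettiUniverse.hodge hHD (AbelianVariety.isSmoothProjective_holds (A := A)) 1).Polarization)
    {φ : Module.End ℚ (bettiCohomology A.X 1)}
    (hφE : φ ∈ (BettiUniverse.hodge hHD (AbelianVariety.isSmoothProjective_holds (A := A)) 1).endAlg)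
    {d : ℚ} (hd : 0 < d) (hφ2 : φ * φ = -(d • 1))
    (hE : ∀ a ∈ (BettiUniverse.hodge hHD (AbelianVariety.isSmoothProjective_holds (A := A)) 1).endAlg,
      ∃ x y : ℚ, a = x • 1 + y • φ)
    (hU : ∀ Y : Module.End ℂ (ℂ ⊗[ℚ] bettiCohomology A.X 1), Y * φ.baseChange ℂ = φ.baseChange ℂ * Y →
      (∀ x y, ψ.form.baseChange ℂ (Y x) y + ψ.form.baseChange ℂ x (Y y) = 0) →
        Y ∈ (BettiUniverse.hodge hHD (AbelianVariety.isSmoothProjective_holds (A := A)) 1).hodgeLieC)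
    {μ : ℂ} (hμ : μ ^ 2 = -(d : ℂ))
    {n₀ : ℕ} (cb : Module.Basis (Fin 2 × Fin n₀) ℂ (ℂ ⊗[ℚ] bettiCohomology A.X 1)) (κ : Fin n₀ → Fin 2)
    (hcbW : ∀ ℓ, cb (0, ℓ) ∈ Module.End.eigenspace (φ.baseChange ℂ) μ)
    (hcbW' : ∀ ℓ, cb (1, ℓ) ∈ Module.End.eigenspace (φ.baseChange ℂ) (-μ))
    (hcb0 : ∀ ℓ, κ ℓ = 0 →
      cb (0, ℓ) ∈ (BettiUniverse.hodge hHD (AbelianVariety.isSmoothProjective_holds (A := A)) 1).piece 1 0 ∧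
      cb (1, ℓ) ∈ (BettiUniverse.hodge hHD (AbelianVariety.isSmoothProjective_holds (A := A)) 1).piece 0 1)
    (hcb1 : ∀ ℓ, κ ℓ = 1 →
      cb (0, ℓ) ∈ (BettiUniverse.hodge hHD (AbelianVariety.isSmoothProjective_holds (A := A)) 1).piece 0 1 ∧
      cb (1, ℓ) ∈ (BettiUniverse.hodge hHD (AbelianVariety.isSmoothProjective_holds (A := A)) 1).piece 1 0)
    (hdual : ∀ i j, ψ.form.baseChange ℂ (cb (0, i)) (cb (1, j)) = if i = j then 1 else 0)
    (hcross : ∀ j j' : Fin n, (∑ ℓ : Fin n₀, cupProduct (rfl : 1 + 1 = 2)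
        (avLetters g (fun tl : Fin 2 × Fin n₀ =>
          ofRatClassBaseChange (Motives.ComplexPoints A.X) 1 (cb tl)) (j, ((0 : Fin 2), ℓ)))
        (avLetters g (fun tl : Fin 2 × Fin n₀ =>
          ofRatClassBaseChange (Motives.ComplexPoints A.X) 1 (cb tl)) (j', ((1 : Fin 2), ℓ)))) ∈
      Submodule.span ℂ {c : complexBetti B.X 2 | IsRationalClass c ∧ IsOfHodgeType B.dim B.X 2 1 1 c}) :
    IsDivisorGenerated B :=
  fun p c hcQ hc => hg.unitaryHodgeClasses_divisorial_of_hodgeLieC hHD hI ψ hφE hd hφ2 hE hU hμ cb κ hcbW hcbW'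
    hcb0 hcb1 hdual hcross p c hcQ hc

end Assembly

/-! ### §4 The geometric assembly: `φ ≫ φ = −d`, `End⁰(A) = ℚ(φ)`, `Hg(A) = U_K(V, ψ)` ⟹ `B = D` on every abelian variety with slots over `A` -/

section Geometric

variable {A B : AbelianVariety ℂ} {n : ℕ} {g : Fin n → (B ⟶ A)}

/-- **`B•(B) = D•(B) ⊗ ℂ` for every abelian variety `B` with slots over `A` when `Hg(A) = U_K(H¹(A;ℚ), ψ)`** — MZ99 (1.8)
⟹ for `D = K` an imaginary quadratic field (Hazama, Murty; Ribet 1983 Thm. 0), ANY multiplicities `(n′, n″)`. Hypotheses: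
`φ ≫ φ = -d` (`d > 0`), `finrank_ℚ End⁰(A) = 2` (so `End⁰(A) = ℚ(φ) ≅ ℚ(√-d)`), `0 < dim A`, and, for a polarization `ψ` of
the `ℚ`-Hodge structure `H¹(A(ℂ); ℚ)` of the tree's Betti universe, `hU`: every `(φ^*)_ℂ`-commuting `ψ_ℂ`-skew operator of
`H¹(A(ℂ); ℂ)` lies in `Lie Hg(H¹(A)) ⊗ ℂ` — i.e. `Lie Hg ⊗ ℂ = 𝔲_K(V, ψ) ⊗ ℂ ≅ 𝔤𝔩(W)`, «`Hg(X) = U_K(V, ψ) = Sp_K(V, φ)`».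
Assembled exactly as the tree's `AVSlots.isDivisorGenerated_of_ribetTypeOne`: the rational datum `φ^*_ℚ ∈ End_Hdg`
(`unop_bettiRep_mem_endAlg`), `(φ^*_ℚ)² = -d` (`bettiMapHom_mul_self`), `End_Hdg = ℚ + ℚφ^*_ℚ`
(`exists_eq_smul_one_add_smul_bettiMapHom`), adapted dual bases (`UnitaryTheta.exists_adaptedDualBasis`), §3, and the crossed
classes are divisor classes (`sum_cupH1_adaptedDualBasis_mem_span_rational_oneOne`, `Milne1999.sum_cross_mem_span_rational_oneOne_of_eigen`).
[cite: MoonenZarhin1999LowDim, §1 (1.8) and §2 (2.3)] [cite: Ribet1983, Thm. 0 and Thm. 3] [cite: Gordon1997, Thm. 6.3 (3) (p. 18)]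
[cite: Milne1999LefschetzClasses, Prop. 3.3 and Prop. 3.6 (c)] -/
theorem AVSlots.isDivisorGenerated_of_hodgeLieC_unitary [HodgeTensorFacts.{0, 0}] (hg : AVSlots A B g) (φ : A ⟶ A) {d : ℕ} (hd : 0 < d)
    (hφ : φ ≫ φ = -(d • 𝟙 A)) (hE2 : Module.finrank ℚ A.endAlgebra = 2) (hA : 0 < A.dim)
    (hHD : exists_isReal_hodgeModel) (hI : hodgePQ_independent_of_hodgeModel)
    (ψ : (BettiUniverse.hodge hHD (AbelianVariety.isSmoothProjective_holds (A := A)) 1).Polarization)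
    (hU : ∀ Y : Module.End ℂ (ℂ ⊗[ℚ] bettiCohomology A.X 1),
      Y * ((bettiCohomology.map φ.hom.hom.hom 1).hom).baseChange ℂ =
          ((bettiCohomology.map φ.hom.hom.hom 1).hom).baseChange ℂ * Y →
        (∀ x y, ψ.form.baseChange ℂ (Y x) y + ψ.form.baseChange ℂ x (Y y) = 0) →
          Y ∈ (BettiUniverse.hodge hHD (AbelianVariety.isSmoothProjective_holds (A := A)) 1).hodgeLieC) :
    IsDivisorGenerated B := by
  classical
  haveI : Module.Finite ℚ (bettiCohomology A.X 1) := finite_bettiCohomology_one A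
  have hX : IsSmoothProjective A.dim A.X := AbelianVariety.isSmoothProjective_holds
  have heff := BettiUniverse.hodge_isEffective hHD hX 1
  -- the rational datum `φ^*_ℚ`
  set φQ : Module.End ℚ (bettiCohomology A.X 1) := (bettiCohomology.map φ.hom.hom.hom 1).hom with hφQ
  have hφE : φQ ∈ (BettiUniverse.hodge hHD (AbelianVariety.isSmoothProjective_holds (A := A)) 1).endAlg := by
    have h := unop_bettiRep_mem_endAlg hHD hI (AbelianVariety.endAlgebra.of A φ)
    rwa [bettiRep_of, MulOpposite.unop_op] at h
  have hφ2 : φQ * φQ = -((d : ℚ) • 1) := bettiMapHom_mul_self hφ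
  have hdQ : (0 : ℚ) < d := Nat.cast_pos.2 hd
  have hE := exists_eq_smul_one_add_smul_bettiMapHom hHD hI hd hφ hE2 hA
  -- the eigenvalue `μ = i√d`
  set μ : ℂ := Complex.I * (Real.sqrt d : ℂ) with hμdef
  have hμ : μ ^ 2 = -((d : ℚ) : ℂ) := by
    rw [hμdef, mul_pow, Complex.I_sq, ← Complex.ofReal_pow, Real.sq_sqrt (Nat.cast_nonneg d),
      Complex.ofReal_natCast, Rat.cast_natCast, neg_one_mul]
  -- adapted dual bases
  obtain ⟨n₀, cb, κ, hcbW, hcbW', hcb0, hcb1, hdual⟩ := UnitaryTheta.exists_adaptedDualBasis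
    (BettiUniverse.hodge hHD (AbelianVariety.isSmoothProjective_holds (A := A)) 1) Nat.cast_one heff ψ hφE
    hdQ hφ2 hE hμ
  refine hg.isDivisorGenerated_of_unitaryData_of_hodgeLieC hHD hI ψ hφE hdQ hφ2 hE hU hμ cb κ hcbW hcbW' hcb0
    hcb1 hdual fun j j' => ?_
  -- the crossed classes are divisor classes
  have hθ := sum_cupH1_adaptedDualBasis_mem_span_rational_oneOne hHD hI ψ hφE hdQ hφ2 hE hμ cb κ hcbW hcbW'
    hcb0 hcb1 hdual
  simp only [cupH1_apply] at hθ
  obtain ⟨hμ0, -⟩ := UnitaryTheta.conj_eq_neg_of_sq hdQ hμ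
  have hne : μ ≠ -μ := fun h => hμ0 (by
    have h2 : (2 : ℂ) * μ = 0 := by rw [two_mul]; nth_rw 2 [h]; exact add_neg_cancel μ
    exact (mul_eq_zero.1 h2).resolve_left two_ne_zero)
  have he : ∀ i, VanGeemen1994.pullbackOne A φ (ofRatClassBaseChange (Motives.ComplexPoints A.X) 1 (cb (0, i))) =
      μ • ofRatClassBaseChange (Motives.ComplexPoints A.X) 1 (cb (0, i)) := fun i => by
    have h := congrArg (ofRatClassBaseChange (Motives.ComplexPoints A.X) 1)
      (Module.End.mem_eigenspace_iff.1 (hcbW i))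
    rw [hφQ, ofRatClassBaseChange_baseChange_bettiMapHom, map_smul] at h
    exact h
  have hf : ∀ i, VanGeemen1994.pullbackOne A φ (ofRatClassBaseChange (Motives.ComplexPoints A.X) 1 (cb (1, i))) =
      (-μ) • ofRatClassBaseChange (Motives.ComplexPoints A.X) 1 (cb (1, i)) := fun i => by
    have h := congrArg (ofRatClassBaseChange (Motives.ComplexPoints A.X) 1)
      (Module.End.mem_eigenspace_iff.1 (hcbW' i))
    rw [hφQ, ofRatClassBaseChange_baseChange_bettiMapHom, map_smul] at h
    exact h
  exact Milne1999.sum_cross_mem_span_rational_oneOne_of_eigen φ (g j) (g j')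
    (fun i => ofRatClassBaseChange (Motives.ComplexPoints A.X) 1 (cb (0, i)))
    (fun i => ofRatClassBaseChange (Motives.ComplexPoints A.X) 1 (cb (1, i))) hne he hf hθ

end Geometric

/-- **MZ99 (1.8) ⟹ for `D = K`, all powers: `B•(A^{N+1}) = D•(A^{N+1}) ⊗ ℂ`** for a complex abelian variety `A` with
`φ ≫ φ = -d` (`d > 0`), `finrank_ℚ End⁰(A) = 2` and `Hg(A) = U_K(H¹(A;ℚ), ψ)` in the Lie form `hU` (any multiplicities).
Hazama / Murty: «`Hg(X) = Sp_D(V,φ)` ⟹ `D(Xⁿ) = B(Xⁿ)` for all `n`». [cite: MoonenZarhin1999LowDim, §1 (1.8)]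
[cite: Ribet1983, Thm. 0] [cite: Gordon1997, Thm. 6.3 (3)] -/
theorem AbelianVariety.isDivisorGenerated_powSucc_of_hodgeLieC_unitary [HodgeTensorFacts.{0, 0}] (A : AbelianVariety ℂ) (φ : A ⟶ A)
    {d : ℕ} (hd : 0 < d) (hφ : φ ≫ φ = -(d • 𝟙 A)) (hE2 : Module.finrank ℚ A.endAlgebra = 2) (hA : 0 < A.dim)
    (hHD : exists_isReal_hodgeModel) (hI : hodgePQ_independent_of_hodgeModel)
    (ψ : (BettiUniverse.hodge hHD (AbelianVariety.isSmoothProjective_holds (A := A)) 1).Polarization)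
    (hU : ∀ Y : Module.End ℂ (ℂ ⊗[ℚ] bettiCohomology A.X 1),
      Y * ((bettiCohomology.map φ.hom.hom.hom 1).hom).baseChange ℂ =
          ((bettiCohomology.map φ.hom.hom.hom 1).hom).baseChange ℂ * Y →
        (∀ x y, ψ.form.baseChange ℂ (Y x) y + ψ.form.baseChange ℂ x (Y y) = 0) →
          Y ∈ (BettiUniverse.hodge hHD (AbelianVariety.isSmoothProjective_holds (A := A)) 1).hodgeLieC)
    (N : ℕ) : IsDivisorGenerated (A.powSucc N) :=
  (AVSlots.powSucc A N).isDivisorGenerated_of_hodgeLieC_unitary φ hd hφ hE2 hA hHD hI ψ hU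

/-- `A` itself: `B•(A) = D•(A) ⊗ ℂ` when `Hg(A) = U_K(H¹(A;ℚ), ψ)` (Lie form `hU`). [cite: MoonenZarhin1999LowDim, §1 (1.8)]
[cite: Ribet1983, Thm. 0] -/
theorem AbelianVariety.isDivisorGenerated_of_hodgeLieC_unitary [HodgeTensorFacts.{0, 0}] (A : AbelianVariety ℂ) (φ : A ⟶ A)
    {d : ℕ} (hd : 0 < d) (hφ : φ ≫ φ = -(d • 𝟙 A)) (hE2 : Module.finrank ℚ A.endAlgebra = 2) (hA : 0 < A.dim)
    (hHD : exists_isReal_hodgeModel) (hI : hodgePQ_independent_of_hodgeModel)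
    (ψ : (BettiUniverse.hodge hHD (AbelianVariety.isSmoothProjective_holds (A := A)) 1).Polarization)
    (hU : ∀ Y : Module.End ℂ (ℂ ⊗[ℚ] bettiCohomology A.X 1),
      Y * ((bettiCohomology.map φ.hom.hom.hom 1).hom).baseChange ℂ =
          ((bettiCohomology.map φ.hom.hom.hom 1).hom).baseChange ℂ * Y →
        (∀ x y, ψ.form.baseChange ℂ (Y x) y + ψ.form.baseChange ℂ x (Y y) = 0) →
          Y ∈ (BettiUniverse.hodge hHD (AbelianVariety.isSmoothProjective_holds (A := A)) 1).hodgeLieC) :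
    IsDivisorGenerated A :=
  (avSlots_self A).isDivisorGenerated_of_hodgeLieC_unitary φ hd hφ hE2 hA hHD hI ψ hU

/-- **The Hodge conjecture for all powers `A^{N+1}` of an abelian variety with `End⁰(A) = ℚ(√-d)` and
`Hg(A) = U_K(H¹(A;ℚ), ψ)`** (`B = D` above with Lefschetz `(1,1)`: the tree's `hodgeConjectureFor_of_isDivisorGenerated`;
MZ99 (1.7): «If this condition is satisfied then the Hodge conjecture is “trivially” true for all `Xⁿ`»).
[cite: MoonenZarhin1999LowDim, §1 (1.7)–(1.8)] [cite: vanGeemen1994HodgeAV, §2.4] -/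
theorem hodgeConjectureFor_powSucc_of_hodgeLieC_unitary [HodgeTensorFacts.{0, 0}] (A : AbelianVariety ℂ) (φ : A ⟶ A)
    {d : ℕ} (hd : 0 < d) (hφ : φ ≫ φ = -(d • 𝟙 A)) (hE2 : Module.finrank ℚ A.endAlgebra = 2) (hA : 0 < A.dim)
    (hHD : exists_isReal_hodgeModel) (hI : hodgePQ_independent_of_hodgeModel)
    (ψ : (BettiUniverse.hodge hHD (AbelianVariety.isSmoothProjective_holds (A := A)) 1).Polarization)
    (hU : ∀ Y : Module.End ℂ (ℂ ⊗[ℚ] bettiCohomology A.X 1),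
      Y * ((bettiCohomology.map φ.hom.hom.hom 1).hom).baseChange ℂ =
          ((bettiCohomology.map φ.hom.hom.hom 1).hom).baseChange ℂ * Y →
        (∀ x y, ψ.form.baseChange ℂ (Y x) y + ψ.form.baseChange ℂ x (Y y) = 0) →
          Y ∈ (BettiUniverse.hodge hHD (AbelianVariety.isSmoothProjective_holds (A := A)) 1).hodgeLieC)
    (N : ℕ) : HodgeConjectureFor (A.powSucc N).dim (A.powSucc N).X :=
  hodgeConjectureFor_of_isDivisorGenerated _
    (AbelianVariety.isDivisorGenerated_powSucc_of_hodgeLieC_unitary A φ hd hφ hE2 hA hHD hI ψ hU N)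

/-- **The Hodge conjecture for every complex abelian variety isogenous to a power of an abelian variety with
`End⁰(A) = ℚ(√-d)` and `Hg(A) = U_K`** (van Geemen Lemma 3.7 = the tree's `HodgeConjectureFor.of_isIsogenous`).
[cite: vanGeemen1994HodgeAV, Lemma 3.7] [cite: MoonenZarhin1999LowDim, §1 (1.8)] -/
theorem hodgeConjectureFor_of_isIsogenous_powSucc_of_hodgeLieC_unitary [HodgeTensorFacts.{0, 0}]
    {A B' : AbelianVariety ℂ} (φ : A ⟶ A)
    {d : ℕ} (hd : 0 < d) (hφ : φ ≫ φ = -(d • 𝟙 A)) (hE2 : Module.finrank ℚ A.endAlgebra = 2) (hA : 0 < A.dim)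
    (hHD : exists_isReal_hodgeModel) (hI : hodgePQ_independent_of_hodgeModel)
    (ψ : (BettiUniverse.hodge hHD (AbelianVariety.isSmoothProjective_holds (A := A)) 1).Polarization)
    (hU : ∀ Y : Module.End ℂ (ℂ ⊗[ℚ] bettiCohomology A.X 1),
      Y * ((bettiCohomology.map φ.hom.hom.hom 1).hom).baseChange ℂ =
          ((bettiCohomology.map φ.hom.hom.hom 1).hom).baseChange ℂ * Y →
        (∀ x y, ψ.form.baseChange ℂ (Y x) y + ψ.form.baseChange ℂ x (Y y) = 0) →
          Y ∈ (BettiUniverse.hodge hHD (AbelianVariety.isSmoothProjective_holds (A := A)) 1).hodgeLieC)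
    {N : ℕ} (hB : B'.IsIsogenous (A.powSucc N)) : HodgeConjectureFor B'.dim B'.X :=
  HodgeConjectureFor.of_isIsogenous hB
    (hodgeConjectureFor_powSucc_of_hodgeLieC_unitary A φ hd hφ hE2 hA hHD hI ψ hU N)

end Literature.AlgebraicGeometry.HodgeTheory

end
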